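import Summits.ResolutionOfSingularities.ResolutionOfSingularities.Theorems.BoundaryLedgerClasses
import Summits.ResolutionOfSingularities.ResolutionOfSingularities.Theorems.ItineraryCutClasses
import Summits.ResolutionOfSingularities.ResolutionOfSingularities.Theorems.LassoCutAxisTails
import Summits.ResolutionOfSingularities.ResolutionOfSingularities.Theorems.NoJump
import HarnessLib


/-!
[WRITER NOTE (decomp-res writer g5): tree file 1/4 of the lens-5 g15 node «ExitLaw» (HOME decomp-res-lens-5/g15/ExitLaw.lean,
sha256 fd5076a831344d35, critic row 119 CLEARED): §1 exponent bookkeeping and §2 the EXIT LAW at state level, VERBATIM.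
The local copy of `NoJump.degree_erase_add` is replaced by the tree's `NoJump.NoJump.degree_erase_add` (gate dedup);
§3 = `ExitLawWalks`,
§4–§6 pieces/kernels = `ExitLawClasses`, the host kernels reaching 31770 BY NAME = `MaxContactCutExitLaw`.  The lens header
below is kept verbatim as the node record.]
# ExitLaw — decomp-res lens-5 («finite/base range + asymptotic regime + bridge»), generation 15

HOST (BY NAME): route `MaxContactCut`, aside stmt-31770 `MaxContactCut.DefectWalksDeep`
(`= TightDefectClasses.DefectWalksTerminateDeep`; tree `ItineraryCutClasses.defectDeep_iff :
DefectWalksTerminateDeep ↔ NoPlateauWalksDeep ∧ NoRecurrentJumpWalksDeep`, asides 31870 / 31871; 31871 PROVED by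
lens-5 g14 `NoJump.lean`, LANDED as tree `Theorems/NoJump` on 2026-08-30 and imported here — rev 1).  Tree-only
imports; `lean check` rc 0 · 0 sorry.

## The lens read (g15): the ORDER-EXCESS axis `m_t := o_t − q`

Along a forced walk from a root `o_t = s_t + |r_t| ≥ q` (tree `order_eq_shade_add_degree`).  BASE RANGE `m = 0`
(order exactly `q`, «floor»), ASYMPTOTIC RANGE `m ≥ 1` («positive excess»), BRIDGE = ABSORPTION (`absorb`: on a
plateau `m_t = 0 ⇒ m_{t+1} = 0`, boundary frozen; EXCESS LEDGER `m_{t+1} = 2m_t − λ_t`, `excess_ledger`) + the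
EXIT LAW below, which sends the whole base range into the ARC-LAW class (DECIDED-MOD-PORT); the RESIDUAL is the
asymptotic range, cut once more by the proximity letters (`NoRepeatRecurrentExcessPlateauxDeep`).  How far must
the base range reach for the bridge to bite?  Exactly `m = 0`: absorption is an equality of ℕ-ledgers and holds at
the floor only; at `m ≥ 1` a total-keep move doubles the excess.

## EXIT LAW (THE NEW THEOREM, state level, PROVED — `not_isEquimultiplePoint_after_order_eq`)

«A cleaned state of order EXACTLY `q` is never followed by a proximity repeat»: `s` cleaned, `ordZero s.F = q`,
`(j, b)` equimultiple (`b_j = 0`), `s' = step q j b s` ⇒ for every other chart `i ≠ j` and every point `b'` with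
`b'_i = b'_j = 0`, `¬ IsEquimultiplePoint q i b' s'`.  No hypothesis on the boundary `r`, on isolation, on the
field or on the characteristic.  Proof = two coefficient-layer identities (§2): the `u_j`-free degree-`q` layer
of the point transform is that of `F` (`coeff_pointTransform_free_top`), and a repeat point on `{u_j = 0}`
empties that layer of `F'` (`no_free_initial_of_repeat`: its `u_i`-minimal monomial would survive in degree
`∈ [1, q−1]`, the values `0, q` of the `u_i`-exponent being deleted `q`-th powers); hence every initial monomial
of `F` carries `u_j`, and the one with the least `u_j`-power is seen by `(j, b)` in degree `< q` — absurd.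
Classical reading: `in_q F ∈ K[u_l − b_l u_j]_{l ≠ j}` is a non-zero binary form in the two linear forms through
the centre direction `v = e_j + Σ b_l e_l`; a repeat at `v' ∈ {u_j = 0}` would put `in_q F'` in `K[u_j, ℓ']`,
whose `u_j`-free part `g·ℓ'^q` is a sum of `q`-th powers, deleted — but that part is `in_q F (u_j := 0) ≠ 0`.
Numerical pre-check (folder `scratch/exitlaw{2,3,4}.py`, engine = lens-5 g14 `model.py`): 0 violations over all
small supports for `(p,q) ∈ {(2,2),(3,3),(2,4),(5,5),(7,7),(2,8),(3,9)}`, arbitrary `b, b'`; consistent with census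
T-plateau-1 (kit j340327): LOST = 0 at all 202 translated root-bed steps with `o_t = q`.

## Consequences (all PROVED here, §3–§5)

* walk form: `ordZero (W.st t).F = q → LeavesNewest W t` (`leavesNewest_of_order_eq`); a proximity repeat needs
  positive excess (`order_gt_of_staysOnNewest`) and IS A SATELLITE MOVE (`satellite_of_staysOnNewest`).
* CELL DECIDED (port-free): lens-3 g12's located sub-residual `NoMasslessProximityLineDeep` is TRUE — the class is
  EMPTY (`noMasslessProximityLine_holds`).
* MAP (port-free, hypothesis-free): THE TWO-COLUMN CUT `DefectWalksTerminateDeep ↔ NoFreePointTailsDeep ∧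
  BoundaryLedger.SatDefectWalksTerminateDeep` (`defectDeep_iff_arc_sat`): g11's bare line and g12's massless line
  drop out (`noBare_of_freeTails : NoFreePointTailsDeep → NoBareTailsDeep`, `noRecurrentProximity_of_sat :
  SatDefectWalksTerminateDeep → NoRecurrentProximityDeep`).
* BRIDGE: ABSORPTION + EXIT LAW ⇒ a plateau that meets the floor is frozen AND NEWEST-FREE from then on
  (`frozen_tail`, `leaves_of_frozen`) ⇒ `NoFrozenPlateauxDeep ⟸ NoFreePointTailsDeep` (`noFrozen_of_freeTails`) — a
  CONVERGENT second closure of the floor cell (the cell itself is lens-3 g14's «FloorCut», DECIDED-MOD-PORT via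
  CJS 2020; critic cn19 (4); no credit claimed here); two loaded components frozen ⇒ axis tail ⇒ impossible
  outright (`no_frozen_two_components`, tree `LassoCut.no_axis_tail`).

## Pieces and tags (host 31770; «why strictly weaker» per piece)

* `NoRecurrentJumpWalksDeep` (tree, BY NAME = aside 31871) · DECIDED (PROVED, lens-5 g14 `NoJump.lean`, critic row 88)
  · WEAKER: a conjunct of 31770 by `defectDeep_iff`, says nothing about plateaux · rev 1: DISCHARGED BY NAME from the
  tree (`noRecurrentJump_holds := NoJump.noRecurrentJumpWalksDeep_holds`), no longer a hypothesis of the kernel.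
* `NoFreePointTailsDeep` (VERBATIM lens-3 g12) · DECIDED-MOD-PORT (desk ARC LAW (A1)–(A6), port `ArcLawPort` = the
  all-`e` `NoFreePointTails`, which is NOT weaker and enters only through `freeTailsDeep_of_all`) · WEAKER:
  necessary by instantiation (`freeTailsDeep_of_defect`); alone it does not touch repeat-recurrent walks.
* `NoFrozenPlateauxDeep` (NEW) · WEAKER: necessary (`noFrozen_of_noPlateau`), silent on `o > q` plateaux ·
  DECIDED-MOD-PORT through the bridge (`noFrozen_of_freeTails`); = lens-3 g14's floor cell (theirs).
* `NoExcessPlateauxDeep` (NEW; = lens-3 g14's announced `NoHighPlateauxDeep`, co-located independently) · WEAKER: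
  necessary (`noExcess_of_noPlateau`), silent on floor plateaux · UNDECIDED · cut further here:
* `NoRepeatRecurrentExcessPlateauxDeep` (NEW) = THE LOCATED RESIDUAL after g15 · WEAKER: necessary
  (`noRepeatExcess_of_noExcess`), silent on floor plateaux and on eventually newest-free ones · UNDECIDED · score 0
  · IDEA-NEEDED (handle: POWER LAW AT REPEATS, `NEXT-g16.md` — classical cone condition `in_q F' ∈ K[u_j, ℓ']`
  layer by layer: a repeat after excess `m` towards `v'` forces the tangent cone of the plane curve
  `{in_{q+m} F = 0}` at `v` to be `(q−m)`-fold UNITANGENT with tangent `v'`) · INSTRUMENTABLE (census T-plateau-1,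
  `plateaux_top` records: excess-throughout plateaux = 89/491 of the `(2,4)` and 69/164 of the `(3,9)` root bed, all
  with satellite moves, 3 alive at the depth cap; 3164/3298 of the mid-tower beds, 0 alive at depth 12; desk
  instrument T-excess-0 (`scratch/texcess1.py`, full census root beds, depth 10, seconds): letter `S` NEVER follows
  a floor state (0 / 7720 `S` in `(2,4)`, 0 / 2537 in `(3,9)` — the exit law on data), 0 power-law violations, every
  excess plateau carrying an inner `S` DIES within ≤ 1 further move in `(2,4)` (136/136) and ≤ 4 in `(3,9)` (59/59),
  and the excess plateaux alive at the cap are all-`F` (0 in `(2,4)`, 3 in `(3,9)`): the residual class is EMPTY on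
  data and «repeats are pre-terminal» is the sharpened conjecture; ask T-excess-1 in `NEXT-g16.md`).
* `NoOriginTails` (rev 1; VERBATIM lens-3 g12, PROVED there, tree landing pending) · DECIDED · NOT weaker (all `e`,
  no shade hypothesis) — a discharge only, like the all-`e` arc law.
* `NoRepeatTranslationRecurrentExcessPlateauxDeep` (rev 1, NEW) = THE JOINT LOCATED RESIDUAL: excess plateaux that
  are repeat-recurrent AND translation-recurrent · WEAKER than 31770 and than the g15 residual by letter
  (`noJoint_of_noRepeatExcess`) · UNDECIDED · score 0 · IDEA-NEEDED · INSTRUMENTABLE (T-excess-0: empty on data;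
  census T-high-0: translated excess steps pre-terminal too) — the INTERSECTION of this seat's proximity axis with
  lens-3 g14's translation axis (`NoHighPlateauxDeepTwo`), cut EXACTLY by `noRepeatExcess_of_origin_joint`.
* `NoMasslessProximityLineDeep` (VERBATIM lens-3 g12) · DECIDED — PROVED TRUE here · WEAKER (necessary, g12).
* `NoRecurrentProximityDeep` (VERBATIM lens-3 g12) · UNDECIDED · now inside g11's satellite column.
* COSTUME: none — no equal-strength translation is used; the only `↔` with 31770 on one side are PROVED exact cuts
  into ≥ 2 necessary pieces (`defectWalksDeep_iff_excess`, `defectWalksDeep_iff_residual`, `defectDeep_iff_arc_sat`).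

KERNEL: `closes : NoRecurrentJumpWalksDeep → NoFreePointTailsDeep → NoRepeatRecurrentExcessPlateauxDeep →
MaxContactCut.DefectWalksDeep`; EXACT: `defectWalksDeep_iff_residual`.  Rev 1 (§6): `closes₁ : NoFreePointTailsDeep →
NoRepeatRecurrentExcessPlateauxDeep → 31770` (g14 discharged from the tree; EXACT `defectWalksDeep_iff_residual₁ :
31770 ↔ arc law ∧ residual`, hypothesis-free) and `closes₂ : NoFreePointTailsDeep → NoOriginTails →
NoRepeatTranslationRecurrentExcessPlateauxDeep → 31770` (EXACT `defectWalksDeep_iff_joint (hO)`).  So, modulo the ARC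
LAW (desk-DECIDED port) alone, `31770 ≡ NoRepeatRecurrentExcessPlateauxDeep`, and modulo the arc law and lens-3's
DECIDED `NoOriginTails`, `31770 ≡ NoRepeatTranslationRecurrentExcessPlateauxDeep`.

WHY NOVEL (searched: tree `rg "order exactly|proximity repeat|StaysOnNewest|massless"` over `Summits/Resolution*`
and `Literature/AlgebraicGeometry/Resolution*` — no statement relating order-`q` states to the next centre's
position; lens-3 g12/g13 locate the massless line as OPEN and close the floor only via the CJS port; lens-1/2/4/6
NODE lines concern other host items; Hauser2010 §G / HauserPerlega2019 §3 analyse kangaroo points (shade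
INCREASES), not the exit from the newest divisor at minimal order): the exit law is a new rigidity statement of the
model, port-free, and it is what empties the massless line and fuses the g11/g12 columns.

Restated VERBATIM (not yet in the tree, byte-identical bodies): `LeavesNewest`, `StaysOnNewest`,
`leavesNewest_iff_not_stays`, `NoFreePointTails`, `NoFreePointTailsDeep`, `NoRecurrentProximityDeep`,
`NoMasslessProximityLineDeep` (lens-3 g12 `ProximityCut.lean` :200–:381), `NoOriginTails` (ibid. / lens-3 g14
`FloorCut.lean` :280); `NoJump.degree_erase_add` (lens-5 g14 `NoJump.lean`; tree copy `Theorems/NoJumpOrderQ.lean`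
:44 in its own
namespace — kept local with the explicit `[Fintype σ]` binder used below).
-/

open MvPolynomial Finset
open scoped BigOperators
open Literature.AlgebraicGeometry.Resolution
open Literature.AlgebraicGeometry.Resolution.Hauser2010
open Literature.AlgebraicGeometry.Resolution.PointBlowup
open Literature.AlgebraicGeometry.Resolution.WeightedBlowup
open Literature.Barriers.ResolutionOfSingularities
open Summit.ResolutionOfSingularities.ResolutionOfSingularities.Theorems.TightDefectClasses
open Summit.ResolutionOfSingularities.ResolutionOfSingularities.Theorems.TightDefectStrongWalks
open Summit.ResolutionOfSingularities.ResolutionOfSingularities.Theorems.ItineraryCutClasses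
open Summit.ResolutionOfSingularities.ResolutionOfSingularities.Theorems.BoundaryLedger

namespace Summit.ResolutionOfSingularities.ResolutionOfSingularities.Theorems.ExitLaw

/-! ## §1 Exponent bookkeeping (every index type) -/

section Exponents

variable {σ : Type*} [DecidableEq σ]

/-- Two comparable exponents of the same degree are equal. [folklore] -/
theorem eq_of_le_of_degree_le {τ : Type*} {f g : τ →₀ ℕ} (h : f ≤ g) (hdeg : g.degree ≤ f.degree) : f = g := by
  classical
  obtain ⟨u, rfl⟩ : ∃ u, g = f + u := ⟨g - f, (add_tsub_cancel_of_le h).symm⟩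
  rw [map_add] at hdeg
  have hu : u.degree = 0 := by omega
  rw [(Finsupp.degree_eq_zero_iff u).mp hu, add_zero]

/-- RIGIDITY OF THE TOP LAYER: two exponents of the same degree, the second minimal at `j`, whose `j`-erasures are
comparable, coincide. [folklore] -/
theorem eq_of_erase_le [Fintype σ] (j : σ) {d d₀ : σ →₀ ℕ} (hdeg : d.degree = d₀.degree) (hmin : d₀ j ≤ d j)
    (hle : d₀.erase j ≤ d.erase j) : d = d₀ := by
  classical
  have h1 := NoJump.degree_erase_add d j
  have h2 := NoJump.degree_erase_add d₀ j
  have h3 := degree_le_degree_of_le hle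
  have hj : d j = d₀ j := by omega
  have h4 : d₀.erase j = d.erase j := eq_of_le_of_degree_le hle (by omega)
  ext l
  by_cases hl : l = j
  · rw [hl, hj]
  · have h5 := congrArg (fun f : σ →₀ ℕ => f l) h4
    simp only [Finsupp.erase_ne hl] at h5
    exact h5.symm

/-- … contrapositive: a DIFFERENT exponent of the same degree, not smaller at `j`, is strictly smaller than the
`j`-erasure somewhere (so its translate cannot produce the erased monomial). [folklore] -/
theorem exists_erase_lt [Fintype σ] (j : σ) {d d₀ : σ →₀ ℕ} (hdeg : d.degree = d₀.degree) (hmin : d₀ j ≤ d j)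
    (hne : d ≠ d₀) : ∃ l, (d.erase j) l < (d₀.erase j) l := by
  by_contra h
  push Not at h
  exact hne (eq_of_erase_le j hdeg hmin (Finsupp.le_def.mpr h))

/-- At degree exactly `q` the chart exponent law is erasure of the chart coordinate. [folklore] -/
theorem chartExponent_eq_erase (q : ℕ) (j : σ) {d : σ →₀ ℕ} (hd : d.degree = q) :
    chartExponent q j d = d.erase j := by
  classical
  ext l
  rw [chartExponent_apply]
  by_cases hl : l = j
  · rw [if_pos hl, hl, Finsupp.erase_same, hd, Nat.sub_self]
  · rw [if_neg hl, Finsupp.erase_ne hl]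

/-- In three variables an exponent of degree `q` vanishing at two distinct coordinates is `q`-th-power. [folklore] -/
theorem isPthPowerExponent_of_two_zeros {q : ℕ} {i j : Fin 3} (hij : i ≠ j) {D : Fin 3 →₀ ℕ}
    (hi : D i = 0) (hj : D j = 0) (hD : D.degree = q) : IsPthPowerExponent q D := by
  rw [isPthPowerExponent_iff]
  intro l
  by_cases hli : l = i
  · rw [hli, hi]; exact dvd_zero _
  by_cases hlj : l = j
  · rw [hlj, hj]; exact dvd_zero _
  have hsum : D.degree = D 0 + D 1 + D 2 := by
    rw [Finsupp.degree_eq_sum, Fin.sum_univ_three]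
  have : D l = q := by
    fin_cases i <;> fin_cases j <;> fin_cases l <;> simp_all
  rw [this]

end Exponents

/-! ## §2 The EXIT LAW at state level (three variables, every field, no hypothesis on `r` or isolation) -/

section States

variable {K : Type*} [Field K] [DecidableEq K]

omit [DecidableEq K] in
/-- THE FREE TOP LAYER IS INERT (PROVED, every index type): at a state all of whose monomials have degree `≥ q`,
the `u_j`-free monomials of degree exactly `q` of the point transform in chart `u_j` at any point `b` (`b_j = 0`)
are those of `F` itself — the chart law fixes them, translation only feeds LOWER `u_j`-free degrees from them, and
every other monomial of `F` carries a positive power of `u_j` after the chart. [new bookkeeping]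
(Sources: Hauser2010 §F, chart expressions.) -/
theorem coeff_pointTransform_free_top {σ : Type*} [Fintype σ] [DecidableEq σ] (q : ℕ) (j : σ) (b : σ → K)
    (hbj : b j = 0) (s : State σ K) (hdeg : ∀ d ∈ s.F.support, q ≤ d.degree) {D : σ →₀ ℕ} (hDj : D j = 0)
    (hD : D.degree = q) : coeff D (pointTransform q j b s) = coeff D s.F := by
  classical
  have hDe : D.erase j = D := by
    ext l
    by_cases hl : l = j
    · rw [hl, Finsupp.erase_same, hDj]
    · rw [Finsupp.erase_ne hl]
  rw [pointTransform_eq_sum, coeff_sum, Finset.sum_eq_single D]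
  · rw [chartExponent_eq_erase q j hD, hDe, coeff_translate_monomial_self]
  · intro d hd hne
    by_cases hdq : d.degree = q
    · obtain ⟨l, hl⟩ := exists_erase_lt j (hdq.trans hD.symm) (by rw [hDj]; exact Nat.zero_le _) hne
      rw [hDe] at hl
      rw [chartExponent_eq_erase q j hdq]
      exact coeff_translate_monomial_eq_zero_of_lt b _ _ _ hl
    · have hgt : q < d.degree := lt_of_le_of_ne (hdeg d hd) (Ne.symm hdq)
      apply coeff_translate_monomial_eq_zero_of_apply_eq_zero b _ _ _ hbj
      show D j < chartExponent q j d j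
      rw [chartExponent_apply, if_pos rfl, hDj]
      omega
  · intro hD'
    rw [MvPolynomial.notMem_support_iff.mp hD', map_zero]
    show coeff D (aeval _ (0 : MvPolynomial σ K)) = 0
    rw [map_zero, coeff_zero]

omit [DecidableEq K] in
/-- NO FREE INITIAL MONOMIAL SURVIVES A PROXIMITY REPEAT (PROVED, three variables): if a cleaned state `s'` with
all monomials of degree `≥ q` admits an equimultiple point `b'` of the chart `u_i` lying on the component
`{u_j = 0}` (`b'_j = 0`, `i ≠ j`), then `F'` has NO monomial of degree `q` free of `u_j`.  (Take such a monomial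
`D₀` with `D₀ i` minimal; its chart-`i` image `D₀ − D₀(i)e_i` keeps its coefficient in the point transform and has
degree `q − D₀ i ∈ [1, q−1]`, since `D₀ i ∈ {0, q}` would make `D₀` a deleted `q`-th power.) [new]
(Sources: Hauser2010 §F; Hauser2010 §G (satellite/proximate points).) -/
theorem no_free_initial_of_repeat (q : ℕ) {i j : Fin 3} (hij : i ≠ j) (b' : Fin 3 → K) (hbi : b' i = 0)
    (hbj : b' j = 0) (s' : State (Fin 3) K) (hclean : deletePthPowers q s'.F = s'.F)
    (hdeg : ∀ D ∈ s'.F.support, q ≤ D.degree) (heq : IsEquimultiplePoint q i b' s') :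
    ∀ D ∈ s'.F.support, D j = 0 → D.degree = q → False := by
  classical
  intro D₁ hD₁ hD₁j hD₁q
  set A := s'.F.support.filter (fun D => D j = 0 ∧ D.degree = q) with hA
  have hAne : A.Nonempty := ⟨D₁, by rw [hA, Finset.mem_filter]; exact ⟨hD₁, hD₁j, hD₁q⟩⟩
  obtain ⟨D₀, hD₀A, hmin⟩ := Finset.exists_min_image A (fun D => D i) hAne
  rw [hA, Finset.mem_filter] at hD₀A
  obtain ⟨hD₀, hD₀j, hD₀q⟩ := hD₀A
  have hne : coeff D₀ s'.F ≠ 0 := MvPolynomial.mem_support_iff.mp hD₀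
  -- the chart-`i` image of `D₀` keeps its coefficient in the point transform
  have hE : coeff (D₀.erase i) (pointTransform q i b' s') = coeff D₀ s'.F := by
    rw [pointTransform_eq_sum, coeff_sum, Finset.sum_eq_single D₀]
    · rw [chartExponent_eq_erase q i hD₀q, coeff_translate_monomial_self]
    · intro D hD hneD
      by_cases hDj : D j = 0
      · by_cases hDq : D.degree = q
        · have hDi : D₀ i ≤ D i := hmin D (by rw [hA, Finset.mem_filter]; exact ⟨hD, hDj, hDq⟩)
          obtain ⟨l, hl⟩ := exists_erase_lt i (hDq.trans hD₀q.symm) hDi hneD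
          rw [chartExponent_eq_erase q i hDq]
          exact coeff_translate_monomial_eq_zero_of_lt b' _ _ _ hl
        · have hgt : q < D.degree := lt_of_le_of_ne (hdeg D hD) (Ne.symm hDq)
          apply coeff_translate_monomial_eq_zero_of_apply_eq_zero b' _ _ _ hbi
          show (D₀.erase i) i < chartExponent q i D i
          rw [Finsupp.erase_same, chartExponent_apply, if_pos rfl]
          omega
      · apply coeff_translate_monomial_eq_zero_of_apply_eq_zero b' _ _ _ hbj
        show (D₀.erase i) j < chartExponent q i D j
        rw [Finsupp.erase_ne (Ne.symm hij), hD₀j, chartExponent_apply, if_neg (Ne.symm hij)]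
        omega
    · intro h
      exact absurd hD₀ h
  -- `D₀ i ∈ [1, q − 1]`, else `D₀` is a deleted `q`-th power
  have hD₀i : 1 ≤ D₀ i := by
    by_contra h0
    push Not at h0
    have h0' : D₀ i = 0 := by omega
    apply hne
    rw [← hclean, coeff_deletePthPowers, if_pos (isPthPowerExponent_of_two_zeros hij h0' hD₀j hD₀q)]
  have hsum := NoJump.degree_erase_add D₀ i
  have hdegE : (D₀.erase i).degree < q := by omega
  have hE0 : D₀.erase i ≠ 0 := by
    intro h0
    apply hne
    rw [← hclean, coeff_deletePthPowers, if_pos]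
    rw [isPthPowerExponent_iff]
    intro l
    by_cases hl : l = i
    · rw [h0, map_zero, zero_add, hD₀q] at hsum
      rw [hl, hsum]
    · rw [← Finsupp.erase_ne hl (f := D₀), h0, Finsupp.coe_zero, Pi.zero_apply]
      exact dvd_zero _
  exact hne (hE ▸ heq (D₀.erase i) hE0 hdegE)

/-- **THE EXIT LAW (state level; PROVED; three variables, every field, no hypothesis on the boundary `r`, on
isolation or on the characteristic).**  Let `s` be a CLEANED state of order EXACTLY `q`, `(j, b)` an equimultiple
point of the chart `u_j` (`b_j = 0`), and `s' = step q j b s`.  Then NO point `b'` of a DIFFERENT chart `u_i` lying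
on the new exceptional component `{u_j = 0}` (`b'_j = 0`) is equimultiple for `s'`: the centre following an
order-`q` state always LEAVES the exceptional component that state's blow-up created.
Proof: by `no_free_initial_of_repeat` the `u_j`-free degree-`q` layer of `F'` is empty; by
`coeff_pointTransform_free_top` that layer is the `u_j`-free degree-`q` layer of `F` (deleted `q`-th powers
included, `F` being cleaned), so EVERY initial monomial of `F` carries `u_j`; the one with the least power
`u_j^{a}`, `1 ≤ a`, then shows up in the point transform in degree `q − a ∈ [1, q−1]` (`a = q` would make it the
deleted `u_j^q`), contradicting equimultiplicity of `(j, b)`. [new]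
(Sources: Hauser2010 §§F–G; HauserPerlega2019 §3 — who do not isolate this rigidity of order-`q` states.) -/
theorem not_isEquimultiplePoint_after_order_eq (q : ℕ) (s : State (Fin 3) K)
    (hclean : deletePthPowers q s.F = s.F) (ho : ordZero s.F = (q : ℕ∞))
    (j : Fin 3) (b : Fin 3 → K) (hbj : b j = 0) (heq : IsEquimultiplePoint q j b s)
    {i : Fin 3} (hij : i ≠ j) (b' : Fin 3 → K) (hbi : b' i = 0) (hbj' : b' j = 0) :
    ¬ IsEquimultiplePoint q i b' (step q j b s) := by
  classical
  intro heq'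
  have hdeg : ∀ d ∈ s.F.support, q ≤ d.degree := by
    intro d hd
    have h1 := ordZero_le_of_coeff_ne_zero s.F d (MvPolynomial.mem_support_iff.mp hd)
    rw [ho] at h1
    exact_mod_cast h1
  have hF' : (step q j b s).F = deletePthPowers q (pointTransform q j b s) := rfl
  have hclean' : deletePthPowers q (step q j b s).F = (step q j b s).F := by
    rw [hF']
    ext d
    rw [coeff_deletePthPowers, coeff_deletePthPowers]
    split_ifs <;> rfl
  have hdeg' : ∀ D ∈ (step q j b s).F.support, q ≤ D.degree := by
    intro D hD
    have h1 := ordZero_le_of_coeff_ne_zero (step q j b s).F D (MvPolynomial.mem_support_iff.mp hD)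
    have h2 := le_ordZero_step_of_isEquimultiplePoint q j b s heq
    exact_mod_cast h2.trans h1
  -- (e) no `u_j`-free initial monomial in `F'`
  have hE := no_free_initial_of_repeat q hij b' hbi hbj' (step q j b s) hclean' hdeg' heq'
  -- (f1) hence none in `F`
  have hf1 : ∀ D : Fin 3 →₀ ℕ, D j = 0 → D.degree = q → coeff D s.F = 0 := by
    intro D hDj hDq
    by_cases hp : IsPthPowerExponent q D
    · rw [← hclean, coeff_deletePthPowers, if_pos hp]
    · by_contra hne
      have h1 := coeff_pointTransform_free_top q j b hbj s hdeg hDj hDq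
      have h2 : coeff D (step q j b s).F = coeff D s.F := by
        rw [hF', coeff_deletePthPowers, if_neg hp, h1]
      exact hE D (MvPolynomial.mem_support_iff.mpr (by rw [h2]; exact hne)) hDj hDq
  -- (f2) the initial monomial with the least power of `u_j` is seen in degree `q − a ∈ [1, q − 1]`
  obtain ⟨⟨d₁, hd₁, hd₁q⟩, -⟩ := (ordZero_eq_nat_iff _ _).mp ho
  set I := s.F.support.filter (fun d => d.degree = q) with hI
  have hIne : I.Nonempty := ⟨d₁, by rw [hI, Finset.mem_filter]; exact ⟨MvPolynomial.mem_support_iff.mpr hd₁, hd₁q⟩⟩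
  obtain ⟨d₀, hd₀I, hmin⟩ := Finset.exists_min_image I (fun d => d j) hIne
  rw [hI, Finset.mem_filter] at hd₀I
  obtain ⟨hd₀, hd₀q⟩ := hd₀I
  have hne : coeff d₀ s.F ≠ 0 := MvPolynomial.mem_support_iff.mp hd₀
  have hd₀j : 1 ≤ d₀ j := by
    by_contra h
    push Not at h
    exact hne (hf1 d₀ (by omega) hd₀q)
  have hcoef : coeff (d₀.erase j) (pointTransform q j b s) = coeff d₀ s.F := by
    rw [pointTransform_eq_sum, coeff_sum, Finset.sum_eq_single d₀]
    · rw [chartExponent_eq_erase q j hd₀q, coeff_translate_monomial_self]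
    · intro d hd hne'
      by_cases hdq : d.degree = q
      · have hdj : d₀ j ≤ d j := hmin d (by rw [hI, Finset.mem_filter]; exact ⟨hd, hdq⟩)
        obtain ⟨l, hl⟩ := exists_erase_lt j (hdq.trans hd₀q.symm) hdj hne'
        rw [chartExponent_eq_erase q j hdq]
        exact coeff_translate_monomial_eq_zero_of_lt b _ _ _ hl
      · have hgt : q < d.degree := lt_of_le_of_ne (hdeg d hd) (Ne.symm hdq)
        apply coeff_translate_monomial_eq_zero_of_apply_eq_zero b _ _ _ hbj
        show (d₀.erase j) j < chartExponent q j d j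
        rw [Finsupp.erase_same, chartExponent_apply, if_pos rfl]
        omega
    · intro h
      exact absurd hd₀ h
  have hsum := NoJump.degree_erase_add d₀ j
  have hdegE : (d₀.erase j).degree < q := by omega
  have hE0 : d₀.erase j ≠ 0 := by
    intro h0
    apply hne
    rw [← hclean, coeff_deletePthPowers, if_pos]
    rw [isPthPowerExponent_iff]
    intro l
    by_cases hl : l = j
    · rw [h0, map_zero, zero_add, hd₀q] at hsum
      rw [hl, hsum]
    · rw [← Finsupp.erase_ne hl (f := d₀), h0, Finsupp.coe_zero, Pi.zero_apply]
      exact dvd_zero _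
  exact hne (hcoef ▸ heq (d₀.erase j) hE0 hdegE)

end States

end Summit.ResolutionOfSingularities.ResolutionOfSingularities.Theorems.ExitLaw
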